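/-
Copyright (c) 2026 the pub-hodgecm-mathlib formalisation cell (harness21).  Prover seat hodgecm-mathlib-F0P3a-p06 (g26), 2026-09-03.  E1 BRICK LEDGER row 56-B3(55-B) «TAME TWINS
OF THE 55-B DATUM FILES», FILE 3 of 3 (E1 keeper ∕ dealer F0P3a-p03 (g30) 04:25:32Z «= ONE HAND»; LEAD F0P3a-plan T15-42 (iii)).
-/
import Summits.HodgeConjecture.HodgeConjecture.Theorems.F0P3cStCharTSHorocyclesAtDatumRamified     -- FILE 1-RAM of 3 (this seat): (X1v) `exists_horocycleIndex_vertices_of_neg`, `apartmentEnum_eq_self_…_of_involution`; brings ★ B-1, (T-I)∕(T-II), ★ R1, ★ B1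
import Summits.HodgeConjecture.HodgeConjecture.Theorems.F0P3cStCharTSBorelDoubleCosetsAtDatum      -- ★ B-3a («LH10» LH10-p02 g14): the PLACE-FREE §5.0 bookkeeping `actionHom_mul_apply ∕ _one_apply ∕ _inv_apply_eq`, `actionHom_zpow_apartmentEnum`, `isCompact_subgroupOf_M_inf` BY NAME
import Literature.NumberTheory.Automorphic.UnitaryLatticeTreeOrbitsViaApartmentOfInvolution       -- (O) («LH5» LH5-p04 g11): `not_exists_latticeGraphIso_apartmentEnum_zero_eq_and_one_eq_of_v` (exclusivity of the two vertex orbits, place-free)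
import HarnessLib

/-!
# Row 56-B3(55-B), FILE 3 of 3 — THE TAME TWIN of ★ 55-B-3a «BOREL DOUBLE COSETS AT THE SPECIAL VERTICES»: `Γ = B · Stab(A 0) = B · Stab(A 1)` and
# `B ∩ Stab(A m) = (T ∩ Stab(A 0)) · (N ∩ Stab(A m))` on the `U(Φ₃)(L⁺_v)` tree at a TAMELY RAMIFIED place (`σ_w ϖ = −ϖ`, `|2|_w = 1`) — Bruhat–Tits 1972 (4.4.3)–(4.4.4), §10

Cell `pub/hodgecm-mathlib` (D-0151), crux H413 = `stmt-HodgeConjecture-24833`; lane `--kind proof --supports stmt-HodgeConjecture-24833 --as helper` (THEOREMS ONLY: no definition ∕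
instance ∕ notation ∕ named fact ∕ `sorry`; count-neutral: closes no node).  Namespace `Summit.HodgeConjecture.HodgeConjecture.Cruxes.H413.F0P3cStCharTSHorocyclesAtDatumRamified` (= FILE
1-RAM's, as ★ B-3a shares ★ B-1's).  Sibling of ★ `F0P3cStCharTSBorelDoubleCosetsAtDatum` (row 55-B-3a, «LH10» LH10-p02 (g14)): its four `hd`-reading heads re-issued with the unramified datum
`hd` replaced POSITIONALLY by place letters — `exists_mem_N_forall_apartmentEnum_eq_of_mem_P_of_involution (hσ hvσ hϖ)` ((T-I) (H8₀) any involution) and `_of_neg (hσ hvσ hϖ hσϖ hres h2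
hnorm)` (the seven TAME letters of ★ `isTree_latticeGraph_three_of_neg`, IN ORDER) for `exists_mem_P_mul_of_apply_apartmentEnum`, `exists_torus_mul_unipotent_of_mem_P_of_apply_apartmentEnum`
and the PACKAGE `borelDoubleCoset_vertex`; every other binder (`(w hw) {ϖ} (eA heA) {a} (ha) (A hA0 hA1) (t ht τM hτM hτA)`, `hm P₀ Pm hP₀ hPm …`) and every conclusion VERBATIM;
proofs = ★ B-3a's over FILE 1-RAM (X1v) `_of_neg`, (T-I)∕(T-II) (H8₀)∕(H8), (O) exclusivity `_of_v`, and ★ B-3a's place-free bookkeeping BY NAME.  Consumer: the NOT-WILD widening of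
row 61's (α)-package supplier ((X3)(X4) at the two vertex types).
HONEST LABEL: count-neutral datum helper; TAME road GO-LOW (LEAD T15-42); WILD (dyadic) places stay PRINT (`h2 : |2| = 1` is a binder); E1 = PRINT until the keeper's charter test;
h413 OPEN; HC_CM is proved only modulo the 7 printed citations (2 remaining named inputs hLiu418 = stmt-HodgeConjecture-24832, h413 = stmt-HodgeConjecture-24833) until rung 0 closes;
nothing printed is asserted here.

## References
* [BruhatTits1972] F. Bruhat, J. Tits, *Groupes réductifs sur un corps local I*, Publ. Math. IHÉS 41 (1972), (4.4.3) (Iwasawa), (4.4.4), §10.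
* [Rogawski1990] J. D. Rogawski, *Automorphic Representations of Unitary Groups in Three Variables*, Ann. of Math. Stud. 123 (1990), §1.10 p. 9, §4.5 p. 45.
* [Serre1980Trees] J.-P. Serre, *Trees* (1980), Ch. II §1.1, Ch. I §6.4.
* [SchneiderStuhler1997] P. Schneider, U. Stuhler, *Representation theory and sheaves on the Bruhat–Tits building*, Publ. Math. IHÉS 85 (1997), §III.4 (Lemma III.4.13).
-/

set_option autoImplicit false
-- the mandated namespace has the single-problem summit's repeated segment (`HodgeConjecture.HodgeConjecture`)
set_option linter.dupNamespace false

noncomputable section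

open NumberField IsDedekindDomain
open scoped Valued WithZero Matrix MatrixGroups
open Literature.NumberTheory.Rogawski1990 Literature.NumberTheory.Automorphic Literature.NumberTheory.Automorphic.UnitaryGroup
open Literature.NumberTheory.Automorphic.UnitaryLatticeTree Literature.NumberTheory.Automorphic.HermitianLattice

namespace Summit.HodgeConjecture.HodgeConjecture.Cruxes.H413.F0P3cStCharTSHorocyclesAtDatumRamified

open Summit.HodgeConjecture.HodgeConjecture.Cruxes.H413.F0P3cStCharTSHorocyclesAtDatum

/-! ## §5-RAM THE BOREL DOUBLE COSETS AT THE TWO VERTEX TYPES at a tame ramified place -/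

section DoubleCoset


variable (L : Type) [Field L] [NumberField L] [IsCMField L] (v : HeightOneSpectrum (𝓞 ↥(maximalRealSubfield L)))
  (w : PlacesOver L v) (hw : IsCMField.complexConj L • w.1 = w.1) {ϖ : w.1.adicCompletion L}
  (eA : Gqs L v ≃ₜ* ↥(unitaryGroupOfForm (galAdicCompletionMap (L := L) (IsCMField.complexConj L) hw) ((StdForm.antidiagonal 3).over (w.1.adicCompletion L))))
  (heA : ∀ g : Gqs L v,
    ((eA g : ↥(unitaryGroupOfForm (galAdicCompletionMap (L := L) (IsCMField.complexConj L) hw) ((StdForm.antidiagonal 3).over (w.1.adicCompletion L)))) :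
        GL (Fin 3) (w.1.adicCompletion L)) =
      ((localNonsplitEquiv (IsCMField.complexConj L) (qsForm L) (IsCMField.complexConj_ne_one L) w hw g :
        ↥(unitaryGroupOfForm (galAdicCompletionMap (L := L) (IsCMField.complexConj L) hw) (placeForm (qsForm L) w.1))) : GL (Fin 3) (w.1.adicCompletion L)))
  {a : Gqs L v →* ((latticeGraph (galAdicCompletionMap (L := L) (IsCMField.complexConj L) hw) ϖ ((StdForm.antidiagonal 3).over (w.1.adicCompletion L))) ≃g
    (latticeGraph (galAdicCompletionMap (L := L) (IsCMField.complexConj L) hw) ϖ ((StdForm.antidiagonal 3).over (w.1.adicCompletion L))))}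
  (ha : ∀ g, a g = latticeGraphIso (galAdicCompletionMap (L := L) (IsCMField.complexConj L) hw) ϖ ((StdForm.antidiagonal 3).over (w.1.adicCompletion L)) (eA g))
  (A : ℤ → {M : Submodule 𝒪[(w.1.adicCompletion L)] (Fin 3 → (w.1.adicCompletion L)) //
    IsVertex (galAdicCompletionMap (L := L) (IsCMField.complexConj L) hw) ϖ ((StdForm.antidiagonal 3).over (w.1.adicCompletion L)) M})
  (hA0 : ∀ c : ℤ, (A (2 * c)).1 = latt (Matrix.diagonal ![ϖ ^ c, (1 : w.1.adicCompletion L), ϖ ^ (-c)]))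
  (hA1 : ∀ c : ℤ, (A (2 * c + 1)).1 = latt (Matrix.diagonal ![ϖ ^ (c + 1), (1 : w.1.adicCompletion L), ϖ ^ (-c)]))
  (t : ParabolicTriple (Gqs L v)) (ht : t = cmBorelTriple L 3 v)
  (τM : Gqs L v) (hτM : τM ∈ t.M) (hτA : ∀ j : ℤ, a τM (A j) = A (j + 2))


include heA ha hA0 hA1 ht in
set_option maxHeartbeats 1600000 in  -- the datum vertex type (= ★ B-3a's budget)
/-- **BOREL ELEMENTS TRANSLATE THE APARTMENT MODULO `N`, any isometric involution** ((T-I) (H8₀) `_of_involution`; twin of ★ `exists_mem_N_forall_apartmentEnum_eq_of_mem_P`, conclusion VERBATIM): for `b ∈ B(L⁺_v)` there are `n ∈ N(L⁺_v)` and `c₀ : ℤ` with `b · A k = n · A (k + 2c₀)` for ALL `k` (write `b = n′ m`,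
`m = proj b ∈ T`, `n′ = b m⁻¹ ∈ N`; the torus part translates the apartment by an even amount, ★ A-II (H8₀)).  [cite: BruhatTits1972, §10] [cite: Rogawski1990, §1.10 p. 9] -/
theorem exists_mem_N_forall_apartmentEnum_eq_of_mem_P_of_involution
    (hσ : ∀ x, (galAdicCompletionMap (L := L) (IsCMField.complexConj L) hw) ((galAdicCompletionMap (L := L) (IsCMField.complexConj L) hw) x) = x)
    (hvσ : ∀ x, Valued.v ((galAdicCompletionMap (L := L) (IsCMField.complexConj L) hw) x) = Valued.v x) (hϖ : Valued.v ϖ = WithZero.exp (-1 : ℤ))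
    {b : Gqs L v} (hb : b ∈ t.P) :
    ∃ n : Gqs L v, n ∈ t.N ∧ ∃ c₀ : ℤ, ∀ k : ℤ, a b (A k) = a n (A (k + 2 * c₀)) := by
  have hM : ∀ g : Gqs L v, g ∈ t.M ↔
      eA g ∈ torusU (galAdicCompletionMap (L := L) (IsCMField.complexConj L) hw) ((StdForm.antidiagonal 3).over (w.1.adicCompletion L)) :=
    fun g => by subst ht; exact mem_cmBorelTriple_M_iff L v w hw eA heA g
  set m : Gqs L v := ((t.proj ⟨b, hb⟩ : ↥t.M) : Gqs L v) with hm
  have hmM : m ∈ t.M := (t.proj ⟨b, hb⟩).2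
  have hn₁ : m⁻¹ * b ∈ t.N := t.proj_inv_mul_mem ⟨b, hb⟩
  have hn' : b * m⁻¹ ∈ t.N := by
    have hnorm := t.le_normalizer (t.M_le hmM)
    have h := (Subgroup.mem_normalizer_iff.1 hnorm (m⁻¹ * b)).1 hn₁
    rwa [mul_inv_cancel_left] at h
  obtain ⟨c₀, hshift, -⟩ := exists_forall_latticeGraphIso_apartmentEnum_eq_add_of_mem_torusU_of_involution hσ hvσ hϖ A hA0 hA1 ((hM m).1 hmM)
  refine ⟨b * m⁻¹, hn', c₀, fun k => ?_⟩
  rw [← hshift k, ← ha, ← actionHom_mul_apply L v w hw eA ha, inv_mul_cancel_right]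

/-! ### §5.1-RAM `Γ = B · Stab(A m)` for `m ∈ {0, 1}` and `B ∩ Stab(A m) = (T ∩ Stab(A 0)) · (N ∩ Stab(A m))` at a tame ramified place -/

include heA ha hA0 hA1 ht hτM hτA in
set_option maxHeartbeats 1600000 in  -- the datum vertex type (= ★ B-3a's budget)
/-- **`Γ = B · Stab(A m)` at a tame ramified place** (FILE 1-RAM (X1v) `_of_neg` + the (O) exclusivity `_of_v` of «LH5» LH5-p04; twin of ★ `exists_mem_P_mul_of_apply_apartmentEnum`, conclusion VERBATIM) (`m = 0`: Iwasawa at the hyperspecial vertex; `m = 1`: at the other special vertex): every `y ∈ Gqs L v` is `h · κ` with `h ∈ B(L⁺_v)` and `κ` fixing `A m`.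
Proof: `x := y · A m` is `tr x · A (idx x)` (B-1 (X1v)); the parity of `idx x` is that of `m` (the two `U`-orbits of vertices, ★ A-III), so `A (idx x) = τM^c · A m` and
`h := tr x · τM^c`. [cite: BruhatTits1972, (4.4.3) and §10] [cite: Rogawski1990, §4.5 p. 45] [cite: Serre1980Trees, II.1.1] -/
theorem exists_mem_P_mul_of_apply_apartmentEnum_of_neg
    (hσ : ∀ x, (galAdicCompletionMap (L := L) (IsCMField.complexConj L) hw) ((galAdicCompletionMap (L := L) (IsCMField.complexConj L) hw) x) = x)
    (hvσ : ∀ x, Valued.v ((galAdicCompletionMap (L := L) (IsCMField.complexConj L) hw) x) = Valued.v x) (hϖ : Valued.v ϖ = WithZero.exp (-1 : ℤ))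
    (hσϖ : (galAdicCompletionMap (L := L) (IsCMField.complexConj L) hw) ϖ = -ϖ)
    (hres : ∀ x : (w.1.adicCompletion L), Valued.v x ≤ 1 → Valued.v ((galAdicCompletionMap (L := L) (IsCMField.complexConj L) hw) x - x) < 1)
    (h2 : Valued.v (2 : (w.1.adicCompletion L)) = 1)
    (hnorm : ∀ u : (w.1.adicCompletion L), (galAdicCompletionMap (L := L) (IsCMField.complexConj L) hw) u = u → Valued.v (u - 1) < 1 →
    ∃ z : (w.1.adicCompletion L), z * (galAdicCompletionMap (L := L) (IsCMField.complexConj L) hw) z = u ∧ Valued.v (z - 1) ≤ Valued.v (u - 1))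
    {m : ℤ} (hm : m = 0 ∨ m = 1) (Pm : Subgroup (Gqs L v)) (hPm : ∀ g, g ∈ Pm ↔ a g (A m) = A m) (y : Gqs L v) :
    ∃ h : Gqs L v, h ∈ t.P ∧ ∃ κ ∈ Pm, y = h * κ := by
  have hN : ∀ g : Gqs L v, g ∈ t.N ↔
      eA g ∈ unipotentU (galAdicCompletionMap (L := L) (IsCMField.complexConj L) hw) ((StdForm.antidiagonal 3).over (w.1.adicCompletion L)) :=
    fun g => by subst ht; exact mem_cmBorelTriple_N_iff L v w hw eA heA g
  obtain ⟨idx, tr, htrN, htr, -, -⟩ := exists_horocycleIndex_vertices_of_neg L v w hw eA heA ha A hA0 hA1 hσ hvσ hϖ hσϖ hres h2 hnorm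
  have htrN' : ∀ x, tr x ∈ t.N := fun x => (hN _).2 (by
    have h := htrN x; subst ht; exact (mem_cmBorelTriple_N_iff L v w hw eA heA _).1 h)
  set x := a y (A m) with hx
  obtain ⟨c, hc⟩ : ∃ c : ℤ, idx x = 2 * c + m := by
    obtain ⟨c, hc | hc⟩ := Int.even_or_odd' (idx x)
    · rcases hm with rfl | rfl
      · exact ⟨c, by rw [hc, add_zero]⟩
      · -- `x` would lie in both vertex orbits
        exfalso
        refine not_exists_latticeGraphIso_apartmentEnum_zero_eq_and_one_eq_of_v hσ hvσ hϖ A hA0 hA1 x ⟨⟨eA (tr x * τM ^ c), ?_⟩, ⟨eA y, ?_⟩⟩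
        · rw [← ha, actionHom_mul_apply L v w hw eA ha, actionHom_zpow_apartmentEnum L v w hw eA ha A τM hτA c 0, zero_add, ← hc, htr]
        · rw [← ha]
    · rcases hm with rfl | rfl
      · exfalso
        refine not_exists_latticeGraphIso_apartmentEnum_zero_eq_and_one_eq_of_v hσ hvσ hϖ A hA0 hA1 x ⟨⟨eA y, ?_⟩, ⟨eA (tr x * τM ^ c), ?_⟩⟩
        · rw [← ha]
        · rw [← ha, actionHom_mul_apply L v w hw eA ha, actionHom_zpow_apartmentEnum L v w hw eA ha A τM hτA c 1, show (1 : ℤ) + 2 * c = 2 * c + 1 by ring, ← hc, htr]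
      · exact ⟨c, hc⟩
  have hh : a (tr x * τM ^ c) (A m) = x := by
    rw [actionHom_mul_apply L v w hw eA ha, actionHom_zpow_apartmentEnum L v w hw eA ha A τM hτA c m, show m + 2 * c = 2 * c + m by ring, ← hc, htr]
  refine ⟨tr x * τM ^ c, mul_mem (t.N_le (htrN' x)) (t.M_le (zpow_mem hτM c)), (tr x * τM ^ c)⁻¹ * y, ?_, by group⟩
  rw [hPm, actionHom_mul_apply L v w hw eA ha]
  exact actionHom_inv_apply_eq L v w hw eA ha hh

include heA ha hA0 hA1 ht in
/-- **`B ∩ Stab(A m) = (T ∩ Stab(A 0)) · (N ∩ Stab(A m))` at a tame ramified place** ((T-II) (H8) `_of_neg` along `eA`; twin of ★ `exists_torus_mul_unipotent_of_mem_P_of_apply_apartmentEnum`, conclusion VERBATIM) (★ A-II (H8) along `eA`): a Borel element fixing `A m` is `c · n` with `c ∈ T(L⁺_v)` fixing EVERY apartment vertex and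
`n ∈ N(L⁺_v)` fixing `A m`. [cite: BruhatTits1972, §10] [cite: Rogawski1990, §1.10 p. 9] -/
theorem exists_torus_mul_unipotent_of_mem_P_of_apply_apartmentEnum_of_neg
    (hσ : ∀ x, (galAdicCompletionMap (L := L) (IsCMField.complexConj L) hw) ((galAdicCompletionMap (L := L) (IsCMField.complexConj L) hw) x) = x)
    (hvσ : ∀ x, Valued.v ((galAdicCompletionMap (L := L) (IsCMField.complexConj L) hw) x) = Valued.v x) (hϖ : Valued.v ϖ = WithZero.exp (-1 : ℤ))
    (hσϖ : (galAdicCompletionMap (L := L) (IsCMField.complexConj L) hw) ϖ = -ϖ)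
    (hres : ∀ x : (w.1.adicCompletion L), Valued.v x ≤ 1 → Valued.v ((galAdicCompletionMap (L := L) (IsCMField.complexConj L) hw) x - x) < 1)
    (h2 : Valued.v (2 : (w.1.adicCompletion L)) = 1)
    (hnorm : ∀ u : (w.1.adicCompletion L), (galAdicCompletionMap (L := L) (IsCMField.complexConj L) hw) u = u → Valued.v (u - 1) < 1 →
    ∃ z : (w.1.adicCompletion L), z * (galAdicCompletionMap (L := L) (IsCMField.complexConj L) hw) z = u ∧ Valued.v (z - 1) ≤ Valued.v (u - 1))
    {b : Gqs L v} (hb : b ∈ t.P) {m : ℤ} (hbm : a b (A m) = A m) :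
    ∃ c n : Gqs L v, c ∈ t.M ∧ (∀ k : ℤ, a c (A k) = A k) ∧ n ∈ t.N ∧ a n (A m) = A m ∧ b = c * n := by
  have hM : ∀ g : Gqs L v, g ∈ t.M ↔
      eA g ∈ torusU (galAdicCompletionMap (L := L) (IsCMField.complexConj L) hw) ((StdForm.antidiagonal 3).over (w.1.adicCompletion L)) :=
    fun g => by subst ht; exact mem_cmBorelTriple_M_iff L v w hw eA heA g
  have hN : ∀ g : Gqs L v, g ∈ t.N ↔
      eA g ∈ unipotentU (galAdicCompletionMap (L := L) (IsCMField.complexConj L) hw) ((StdForm.antidiagonal 3).over (w.1.adicCompletion L)) :=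
    fun g => by subst ht; exact mem_cmBorelTriple_N_iff L v w hw eA heA g
  have hP : ∀ g : Gqs L v, g ∈ t.P ↔
      eA g ∈ borelU (galAdicCompletionMap (L := L) (IsCMField.complexConj L) hw) ((StdForm.antidiagonal 3).over (w.1.adicCompletion L)) :=
    fun g => by subst ht; exact mem_cmBorelTriple_P_iff L v w hw eA heA g
  rw [ha] at hbm
  obtain ⟨tt, n, httT, -, hnN, hbn, -, httA, hnA⟩ := exists_torusU_mul_unipotentU_of_mem_borelU_of_latticeGraphIso_apartmentEnum_eq_of_neg hσ hvσ hϖ hσϖ hres h2 hnorm A hA0 hA1 ((hP b).1 hb) hbm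
  refine ⟨eA.symm tt, eA.symm n, (hM _).2 ?_, fun k => ?_, (hN _).2 ?_, ?_, ?_⟩
  · rw [ContinuousMulEquiv.apply_symm_apply]; exact httT
  · rw [ha, ContinuousMulEquiv.apply_symm_apply]; exact httA k
  · rw [ContinuousMulEquiv.apply_symm_apply]; exact hnN
  · rw [ha, ContinuousMulEquiv.apply_symm_apply]; exact hnA
  · apply eA.injective; rw [map_mul, ContinuousMulEquiv.apply_symm_apply, ContinuousMulEquiv.apply_symm_apply]; exact hbn

include heA ha hA0 hA1 ht hτM hτA in
set_option maxHeartbeats 1600000 in  -- the datum vertex type (= ★ B-3a's budget)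
/-- **(X3∕X4) THE (α) PACKAGE AT A SPECIAL VERTEX `A m`, `m ∈ {0,1}`, at a tame ramified place** (`hd ↦ hσ hvσ hϖ hσϖ hres h2 hnorm` POSITIONAL; twin of ★ `borelDoubleCoset_vertex`, conclusion VERBATIM) (`ι := Unit`, `g := 1`, `H := B = t.P`, `K := Stab(A m)`, `T () := B ⊓ K`,
`C () := (T ∩ Stab(A 0)).subgroupOf (B ⊓ K)`, `N () := t.N.subgroupOf (B ⊓ K)`): the binders `hcover hdisj hT hdec hC` of ★ `Representation.finrank_intertwiningMap_smoothIndRep_eq_sum_finrank_eigen`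
at the datum, token for token after that instantiation. [cite: BruhatTits1972, (4.4.3)–(4.4.4) and §10] [cite: Rogawski1990, §1.10 p. 9; §4.5 p. 45] [cite: SchneiderStuhler1997, §III.4] -/
theorem borelDoubleCoset_vertex_of_neg
    (hσ : ∀ x, (galAdicCompletionMap (L := L) (IsCMField.complexConj L) hw) ((galAdicCompletionMap (L := L) (IsCMField.complexConj L) hw) x) = x)
    (hvσ : ∀ x, Valued.v ((galAdicCompletionMap (L := L) (IsCMField.complexConj L) hw) x) = Valued.v x) (hϖ : Valued.v ϖ = WithZero.exp (-1 : ℤ))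
    (hσϖ : (galAdicCompletionMap (L := L) (IsCMField.complexConj L) hw) ϖ = -ϖ)
    (hres : ∀ x : (w.1.adicCompletion L), Valued.v x ≤ 1 → Valued.v ((galAdicCompletionMap (L := L) (IsCMField.complexConj L) hw) x - x) < 1)
    (h2 : Valued.v (2 : (w.1.adicCompletion L)) = 1)
    (hnorm : ∀ u : (w.1.adicCompletion L), (galAdicCompletionMap (L := L) (IsCMField.complexConj L) hw) u = u → Valued.v (u - 1) < 1 →
    ∃ z : (w.1.adicCompletion L), z * (galAdicCompletionMap (L := L) (IsCMField.complexConj L) hw) z = u ∧ Valued.v (z - 1) ≤ Valued.v (u - 1))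
    {m : ℤ} (hm : m = 0 ∨ m = 1) (P₀ Pm : Subgroup (Gqs L v)) (hP₀ : ∀ g, g ∈ P₀ ↔ a g (A 0) = A 0) (hPm : ∀ g, g ∈ Pm ↔ a g (A m) = A m) :
    (∀ y : Gqs L v, ∃ _ : Unit, ∃ h : ↥t.P, ∃ κ ∈ Pm, y = (h : Gqs L v) * 1 * κ) ∧
    (∀ i j : Unit, (∃ h : ↥t.P, ∃ κ ∈ Pm, (1 : Gqs L v) = (h : Gqs L v) * 1 * κ) → i = j) ∧
    (∀ (_ : Unit) (y : Gqs L v), y ∈ t.P ⊓ Pm ↔ y ∈ t.P ∧ (1 : Gqs L v)⁻¹ * y * 1 ∈ Pm) ∧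
    (∀ (_ : Unit) (x : ↥(t.P ⊓ Pm)), ∃ c ∈ (t.M ⊓ P₀).subgroupOf (t.P ⊓ Pm), ∃ n ∈ t.N.subgroupOf (t.P ⊓ Pm), x = c * n) ∧
    (∀ _ : Unit, IsCompact (((t.M ⊓ P₀).subgroupOf (t.P ⊓ Pm) : Subgroup ↥(t.P ⊓ Pm)) : Set ↥(t.P ⊓ Pm))) := by
  refine ⟨fun y => ?_, fun _ _ _ => Subsingleton.elim _ _, fun _ y => by rw [Subgroup.mem_inf, inv_one, one_mul, mul_one], fun _ x => ?_, fun _ => ?_⟩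
  · obtain ⟨h, hh, κ, hκ, hy⟩ := exists_mem_P_mul_of_apply_apartmentEnum_of_neg L v w hw eA heA ha A hA0 hA1 t ht τM hτM hτA hσ hvσ hϖ hσϖ hres h2 hnorm hm Pm hPm y
    exact ⟨(), ⟨h, hh⟩, κ, hκ, by rw [mul_one]; exact hy⟩
  · obtain ⟨c, n, hcM, hcA, hnN, hnA, hx⟩ :=
      exists_torus_mul_unipotent_of_mem_P_of_apply_apartmentEnum_of_neg L v w hw eA heA ha A hA0 hA1 t ht hσ hvσ hϖ hσϖ hres h2 hnorm (Subgroup.mem_inf.1 x.2).1 ((hPm x).1 (Subgroup.mem_inf.1 x.2).2)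
    have htP : t.M ≤ t.P := t.M_le
    have hNP : t.N ≤ t.P := t.N_le
    refine ⟨⟨c, Subgroup.mem_inf.2 ⟨htP hcM, (hPm c).2 (hcA m)⟩⟩, Subgroup.mem_subgroupOf.2 (Subgroup.mem_inf.2 ⟨hcM, (hP₀ c).2 (hcA 0)⟩),
      ⟨n, Subgroup.mem_inf.2 ⟨hNP hnN, (hPm n).2 hnA⟩⟩, Subgroup.mem_subgroupOf.2 hnN, Subtype.ext hx⟩
  · refine isCompact_subgroupOf_M_inf L v w hw eA heA ha t ht P₀ (A 0) hP₀ _ fun c hc => Subgroup.mem_inf.2 ⟨t.M_le (Subgroup.mem_inf.1 hc).1, (hPm c).2 ?_⟩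
    have hcM : c ∈ (cmBorelTriple L 3 v : ParabolicTriple (Gqs L v)).M := by have h := (Subgroup.mem_inf.1 hc).1; subst ht; exact h
    exact apartmentEnum_eq_self_of_mem_cmBorelTriple_M_of_apply_zero_of_involution L v w hw eA heA ha A hA0 hA1 hσ hvσ hϖ hcM ((hP₀ c).1 (Subgroup.mem_inf.1 hc).2) m

/-! ### ED. 2 (append-only behind p853571): the tame twin of ★ B-3a ED. 2's docking one-liners `hCM ∕ hCT ∕ hr` for the vertex packages -/

include heA ha hA0 hA1 ht in
set_option maxHeartbeats 1600000 in  -- the datum vertex type (= ★ B-3a ED. 2's budget)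
/-- **DOCKING ONE-LINERS FOR THE VERTEX PACKAGES, any isometric involution** (twin of ★ B-3a ED. 2 `borelDoubleCoset_vertex_dock`: its one `hd` read is ★ B-1
`apartmentEnum_eq_self_of_mem_cmBorelTriple_M_of_apply_zero`, replaced by FILE 1-RAM's `…_of_involution (hσ hvσ hϖ)` — so three place letters suffice and a `_of_neg` caller passes its
first three; conclusion VERBATIM): at `C := t.M ⊓ P₀`, `g := 1`, `T := t.P ⊓ Pm`, `x₀ := A m`, `R₀ := Set.range A` — `T ∩ Stab(A 0) ≤ T`; `T ∩ Stab(A 0) ≤ B ∩ Stab(A m)`;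
`1 · A m ∈ 𝒜`.  Valid for every `m : ℤ`. [cite: BruhatTits1972, §10] [cite: Serre1980Trees, II.1.1] -/
theorem borelDoubleCoset_vertex_dock_of_involution
    (hσ : ∀ x, (galAdicCompletionMap (L := L) (IsCMField.complexConj L) hw) ((galAdicCompletionMap (L := L) (IsCMField.complexConj L) hw) x) = x)
    (hvσ : ∀ x, Valued.v ((galAdicCompletionMap (L := L) (IsCMField.complexConj L) hw) x) = Valued.v x) (hϖ : Valued.v ϖ = WithZero.exp (-1 : ℤ))
    (m : ℤ) (P₀ Pm : Subgroup (Gqs L v)) (hP₀ : ∀ g, g ∈ P₀ ↔ a g (A 0) = A 0) (hPm : ∀ g, g ∈ Pm ↔ a g (A m) = A m) :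
    ((t.M ⊓ P₀ : Subgroup (Gqs L v)) ≤ t.M) ∧ ((t.M ⊓ P₀ : Subgroup (Gqs L v)) ≤ t.P ⊓ Pm) ∧ (a 1 (A m) ∈ Set.range A) := by
  refine ⟨inf_le_left, fun c hc => Subgroup.mem_inf.2 ⟨t.M_le (Subgroup.mem_inf.1 hc).1, (hPm c).2 ?_⟩, ⟨m, (actionHom_one_apply L v w hw eA ha (A m)).symm⟩⟩
  have hcM : c ∈ (cmBorelTriple L 3 v : ParabolicTriple (Gqs L v)).M := by have h := (Subgroup.mem_inf.1 hc).1; subst ht; exact h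
  exact apartmentEnum_eq_self_of_mem_cmBorelTriple_M_of_apply_zero_of_involution L v w hw eA heA ha A hA0 hA1 hσ hvσ hϖ hcM ((hP₀ c).1 (Subgroup.mem_inf.1 hc).2) m

end DoubleCoset

end Summit.HodgeConjecture.HodgeConjecture.Cruxes.H413.F0P3cStCharTSHorocyclesAtDatumRamified

end
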